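import Summits.QuantumFields.YangMills.Theorems.IsotropyFromPowerCountingCurvatureSandwichBoundChainEngine
import Summits.QuantumFields.YangMills.Theorems.DiagonalMirrorRPR.Negative.InfiniteCouplingSlice
import Summits.QuantumFields.YangMills.Theorems.PencilRigidityNPointIsotropySandwichVacuumRowOfKernelHelpers
import HarnessLib

/-!
# The heat-sandwich row with exponent `μ = 0` for families of ORDER ZERO (model-blind)

Support file for the crux `MirrorModularBoosts.SoftKernelBoostCovariance` (stmt-QuantumFields-14999), line `Sketch`
(lead c9): the second input of the tame-sector certificate of the crux.

A one-species family `S` on `ℝ⁴` is of ORDER ZERO (with geometric constants) if `‖𝔖ₘ F‖ ≤ Aᵐ ∫ ‖F‖` for every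
degree `m` and every `F ∈ ⁰𝒮`.  For such a family and ANY `e₀`-reconstruction `h : OSReconstructionNoE1`, the
transversely filtered heat-sandwich row of the crux holds with exponent `μ = 0` and constant `C = A/2`:
`‖Ψ_{f₁ ⊗ T_{2u+v} W}‖ ≤ C · Mg · (Mh + Mh') · (u⁰ + v⁰) · ‖Ψ_W‖` for every windowed insertion `f₁ = g ⊗ hh`
(`∫|g| ≤ Mg`, `∫|hh| ≤ Mh`, `|hh| ≤ Mh'`) and every admissible time-ordered `W` (`sandwich_of_orderZero`).

Proof: the landed engine of crux Σ (`CurvatureSandwichBound.Sketch.sandwich_of_chainGrowth`, p-landed 2026-08-17: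
iterated Schwarz / multiple reflections, Glimm–Jaffe Thm 10.5.5 in signed vector-end form) reduces the row to the
GROWTH of the signed chain moments `Re 𝔖(ΘW* ⊗ P^N W)`, `P G = T_s(f₁† ⊗ f₁ ⊗ T_s G)`; for an order-zero family
these are at most `A^{2n+2N} (∫|W|)² (∫|f₁|)^{2N}` because translations, the OS adjoint and appended tensor
products are `L¹`-isometric (`integral_norm_translateMulti`, `integral_norm_osAdjoint`, `integral_norm_appendTensor`),
i.e. geometric at rate `Λ² = (A ∫|f₁|)²`, and `∫|f₁| = ∫|g| · ∫|hh| ≤ Mg · Mh` (`integral_norm_window_le`).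
Order zero is inherited by every pull-back along a linear isometry (`orderZero_pullBack`), so the same row holds
for the `45°` pull-back of the crux.

References: J. Glimm, A. Jaffe, Quantum Physics (1987) Thm 10.5.5, §19.5; K. Osterwalder, R. Schrader, Comm. Math.
Phys. 31 (1973) §4.1.
-/

noncomputable section

open scoped SchwartzMap BigOperators InnerProductSpace ComplexConjugate
open MeasureTheory Filter Topology
open Literature.MathematicalPhysics.QuantumFieldTheory Literature.MathematicalPhysics.QuantumLattice
open Literature.MathematicalPhysics.AQFT
open Summit.QuantumFields.YangMills.Theorems.NPointIsotropy.Negative (E4)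
open Summit.QuantumFields.YangMills.Theorems.DiagonalMirrorRPR.Negative (appendSplit appendSplit_apply
  measurePreserving_appendSplit)
open Summit.QuantumFields.YangMills.Theorems.NPointIsotropy.ComplexRotationBandlimit.SandwichVacuumRow
  (exists_planarTransverseSplit)
open Summit.QuantumFields.YangMills.Theorems.CurvatureSandwichBound.Sketch
  (sandwich_of_chainGrowth adm_iterate' tsupport_subset_window)

namespace Summit.QuantumFields.YangMills.Theorems.SoftKernelBoostCovariance.Sketch.TameSector

/-! ## `L¹` bookkeeping: translations, the OS adjoint, appended tensors, isometric pull-backs -/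

section L1

variable {n m : ℕ}

/-- Diagonal translations preserve the `L¹` norm of an `n`-point test function. [folklore] -/
theorem integral_norm_translateMulti (a : E4) (F : 𝓢((Fin n → E4), ℂ)) :
    ∫ x, ‖translateMulti a F x‖ = ∫ x, ‖F x‖ := by
  let e : (Fin n → E4) ≃ᵐ (Fin n → E4) :=
    MeasurableEquiv.piCongrRight fun _ => (MeasurableEquiv.subRight a)
  have he : MeasurePreserving e volume volume :=
    volume_preserving_pi fun _ => measurePreserving_sub_right volume a
  have h : (fun x => ‖translateMulti a F x‖) = fun x => (fun y => ‖F y‖) (e x) := by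
    funext x
    rw [translateMulti_apply]
    rfl
  rw [h]
  exact he.integral_comp' (fun y => ‖F y‖)

/-- The OS adjoint `ΘF*` preserves the `L¹` norm. [folklore] -/
theorem integral_norm_osAdjoint (F : 𝓢((Fin n → E4), ℂ)) :
    ∫ x, ‖osAdjoint F x‖ = ∫ x, ‖F x‖ := by
  let e₁ : (Fin n → E4) ≃ᵐ (Fin n → E4) := (MeasurableEquiv.piCongrLeft (fun _ : Fin n => E4) Fin.revPerm).symm
  let e₂ : (Fin n → E4) ≃ᵐ (Fin n → E4) :=
    MeasurableEquiv.piCongrRight fun _ => (timeReflection 4).toHomeomorph.toMeasurableEquiv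
  have h₁ : MeasurePreserving e₁ volume volume :=
    (volume_measurePreserving_piCongrLeft (fun _ : Fin n => E4) Fin.revPerm).symm _
  have h₂ : MeasurePreserving e₂ volume volume :=
    volume_preserving_pi fun _ => (timeReflection 4).measurePreserving
  have h12 : MeasurePreserving (e₁.trans e₂) volume volume := h₂.comp h₁
  have he : (fun x => ‖osAdjoint F x‖) = fun x => (fun y => ‖F y‖) ((e₁.trans e₂) x) := by
    funext x
    rw [osAdjoint_apply, Complex.norm_conj]
    rfl
  rw [he, h12.integral_comp' (fun y => ‖F y‖)]

/-- `∫ |A ⊗ B| = (∫ |A|)(∫ |B|)` for appended tensor products. [folklore] -/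
theorem integral_norm_appendTensor (A : 𝓢((Fin n → E4), ℂ)) (B : 𝓢((Fin m → E4), ℂ)) :
    ∫ x, ‖A.appendTensor B x‖ = (∫ y, ‖A y‖) * ∫ z, ‖B z‖ := by
  have h1 : (fun x => ‖A.appendTensor B x‖) =
      fun x => (fun p : (Fin n → E4) × (Fin m → E4) => ‖A p.1‖ * ‖B p.2‖) (appendSplit n m x) := by
    funext x
    rw [SchwartzMap.appendTensor_apply, norm_mul, appendSplit_apply]
  rw [h1]
  exact ((measurePreserving_appendSplit n m).integral_comp'
    (fun p : (Fin n → E4) × (Fin m → E4) => ‖A p.1‖ * ‖B p.2‖)).trans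
      (integral_prod_mul (fun y : Fin n → E4 => ‖A y‖) (fun z : Fin m → E4 => ‖B z‖))

/-- The diagonal action of a linear isometry preserves the `L¹` norm. [folklore] -/
theorem integral_norm_linActMulti (R : E4 ≃ₗᵢ[ℝ] E4) (F : 𝓢((Fin n → E4), ℂ)) :
    ∫ x, ‖linActMulti R F x‖ = ∫ x, ‖F x‖ := by
  let e : (Fin n → E4) ≃ᵐ (Fin n → E4) :=
    MeasurableEquiv.piCongrRight fun _ => R.symm.toHomeomorph.toMeasurableEquiv
  have he : MeasurePreserving e volume volume :=
    volume_preserving_pi fun _ => R.symm.measurePreserving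
  exact he.integral_comp' (fun x => ‖F x‖)

/-- **The `L¹` mass of a windowed insertion**: for `f₁(x) = g(x⁰,x¹) hh(x²,x³)` on the one-point space
`(ℝ⁴)¹`, `∫ |f₁| ≤ Mg · Mh` whenever `∫|g| ≤ Mg` and `∫|hh| ≤ Mh` (planar/transverse Tonelli). [folklore] -/
theorem integral_norm_window_le (f₁ : 𝓢((Fin 1 → E4), ℂ)) {g hh : ℝ × ℝ → ℂ} {Mg Mh : ℝ}
    (hf₁ : ∀ x : Fin 1 → E4, f₁ x = g (x 0 0, x 0 1) * hh (x 0 2, x 0 3))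
    (hgM : (∫ p, ‖g p‖) ≤ Mg) (hhM : (∫ p, ‖hh p‖) ≤ Mh) :
    (∫ x, ‖f₁ x‖) ≤ Mg * Mh := by
  have hMg : 0 ≤ Mg := (integral_nonneg fun _ => norm_nonneg _).trans hgM
  -- `(ℝ⁴)¹ ≅ ℝ⁴ ≅ ℝ² × ℝ²`
  obtain ⟨e, he, hex⟩ := exists_planarTransverseSplit
  have hfu : MeasurePreserving (MeasurableEquiv.funUnique (Fin 1) E4) volume volume :=
    volume_preserving_funUnique (Fin 1) E4
  have h1 : (∫ x : Fin 1 → E4, ‖f₁ x‖) = ∫ q : E4, ‖g (q 0, q 1)‖ * ‖hh (q 2, q 3)‖ := by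
    rw [← hfu.symm _ |>.integral_comp' (fun x : Fin 1 → E4 => ‖f₁ x‖)]
    refine integral_congr_ae (Eventually.of_forall fun q => ?_)
    show ‖f₁ ((MeasurableEquiv.funUnique (Fin 1) E4).symm q)‖ = _
    rw [hf₁, norm_mul]
    rfl
  have h2 : (∫ q : E4, ‖g (q 0, q 1)‖ * ‖hh (q 2, q 3)‖) =
      ∫ z : (ℝ × ℝ) × (ℝ × ℝ), ‖g z.1‖ * ‖hh z.2‖ := by
    rw [← he.integral_comp' (fun z : (ℝ × ℝ) × (ℝ × ℝ) => ‖g z.1‖ * ‖hh z.2‖)]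
    refine integral_congr_ae (Eventually.of_forall fun q => ?_)
    simp only [hex]
  have h3 : (∫ z : (ℝ × ℝ) × (ℝ × ℝ), ‖g z.1‖ * ‖hh z.2‖) = (∫ p, ‖g p‖) * ∫ p, ‖hh p‖ :=
    integral_prod_mul (fun p : ℝ × ℝ => ‖g p‖) (fun p : ℝ × ℝ => ‖hh p‖)
  rw [h1, h2, h3]
  exact mul_le_mul hgM hhM (integral_nonneg fun _ => norm_nonneg _) hMg

end L1

/-! ## Order zero is inherited by isometric pull-backs -/

/-- **Order zero passes to the pull-back** `n ↦ 𝔖ₙ ∘ (R ·)` along any linear isometry `R` of `ℝ⁴` (with the same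
constants): `linActMulti R` preserves `⁰𝒮` and the `L¹` norm. [folklore] -/
theorem orderZero_pullBack (S : SchwingerFamily E4) {A : ℝ}
    (hA : ∀ (m : ℕ) (F : 𝓢((Fin m → E4), ℂ)), IsOffDiagonal F → ‖S m F‖ ≤ A ^ m * ∫ y, ‖F y‖)
    (R : E4 ≃ₗᵢ[ℝ] E4) (m : ℕ) (F : 𝓢((Fin m → E4), ℂ)) (hF : IsOffDiagonal F) :
    ‖(fun n => (S n).comp (linActMulti R) : SchwingerFamily E4) m F‖ ≤ A ^ m * ∫ y, ‖F y‖ := by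
  show ‖S m (linActMulti R F)‖ ≤ _
  rw [← integral_norm_linActMulti R F]
  exact hA m _ (Summit.QuantumFields.YangMills.Theorems.CurvatureBoostCovariance.Negative.isOffDiagonal_linActMulti hF R)

/-! ## Chain `L¹` norms -/

/-- **The chain step multiplies the `L¹` norm by `(∫|f₁|)²`**: `∫ |P G| = (∫|f₁|)² ∫ |G|` for
`P G = T_s(f₁† ⊗ f₁ ⊗ T_s G)`, hence `∫ |P^N A| = (∫|f₁|)^{2N} ∫ |A|`. [folklore] -/
theorem integral_norm_iterate (s : ℝ) (f₁ : 𝓢((Fin 1 → E4), ℂ))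
    (P : (Σ m : ℕ, 𝓢((Fin m → E4), ℂ)) → (Σ m : ℕ, 𝓢((Fin m → E4), ℂ)))
    (hP : P = fun Gσ => ⟨1 + (1 + Gσ.1), translateMulti (s • EuclideanSpace.single 0 1)
      ((osAdjoint f₁).appendTensor
        (f₁.appendTensor (translateMulti (s • EuclideanSpace.single 0 1) Gσ.2)))⟩)
    (N : ℕ) (A : Σ m : ℕ, 𝓢((Fin m → E4), ℂ)) :
    (∫ x, ‖(P^[N] A).2 x‖) = (∫ x, ‖f₁ x‖) ^ (2 * N) * ∫ x, ‖A.2 x‖ := by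
  induction N generalizing A with
  | zero =>
    show (∫ x, ‖A.2 x‖) = (∫ x, ‖f₁ x‖) ^ (2 * 0) * ∫ x, ‖A.2 x‖
    rw [Nat.mul_zero, pow_zero, one_mul]
  | succ N ih =>
    rw [Function.iterate_succ_apply, ih (P A), hP]
    simp only
    rw [integral_norm_translateMulti, integral_norm_appendTensor, integral_norm_osAdjoint,
      integral_norm_appendTensor, integral_norm_translateMulti]
    ring

/-- **The degree of the chain**: `deg (P^N A) = 2N + deg A`. [folklore] -/
theorem fst_iterate (s : ℝ) (f₁ : 𝓢((Fin 1 → E4), ℂ))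
    (P : (Σ m : ℕ, 𝓢((Fin m → E4), ℂ)) → (Σ m : ℕ, 𝓢((Fin m → E4), ℂ)))
    (hP : P = fun Gσ => ⟨1 + (1 + Gσ.1), translateMulti (s • EuclideanSpace.single 0 1)
      ((osAdjoint f₁).appendTensor
        (f₁.appendTensor (translateMulti (s • EuclideanSpace.single 0 1) Gσ.2)))⟩)
    (N : ℕ) (A : Σ m : ℕ, 𝓢((Fin m → E4), ℂ)) : (P^[N] A).1 = 2 * N + A.1 := by
  induction N generalizing A with
  | zero =>
    show A.1 = 2 * 0 + A.1
    rw [Nat.mul_zero, Nat.zero_add]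
  | succ N ih =>
    rw [Function.iterate_succ_apply, ih (P A), hP]
    simp only
    ring

/-! ## The sandwich row with exponent `μ = 0` for order-zero families -/

/-- **Chain growth for order-zero families**: the signed chain moments of an order-zero family grow geometrically
at rate `(A ∫|f₁|)²`: `Re 𝔖(ΘW* ⊗ P^N W) ≤ A^{2n} (∫|W|)² · (A ∫|f₁|)^{2N}`. [folklore] -/
theorem chainGrowth_of_orderZero (S : SchwingerFamily E4) {A : ℝ}
    (hA : ∀ (m : ℕ) (F : 𝓢((Fin m → E4), ℂ)), IsOffDiagonal F → ‖S m F‖ ≤ A ^ m * ∫ y, ‖F y‖)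
    (u v : ℝ) (hu : 0 < u) (hv : 0 < v) (f₁ : 𝓢((Fin 1 → E4), ℂ))
    (hf₁ : tsupport (f₁ : (Fin 1 → E4) → ℂ) ⊆ {x | u ≤ x 0 0 ∧ x 0 0 ≤ 2 * u})
    {n : ℕ} (W : 𝓢((Fin n → E4), ℂ)) (hW : IsTimeOrdered W)
    (hFW : IsTimeOrdered (f₁.appendTensor (translateMulti ((2 * u + v) • EuclideanSpace.single 0 1) W)))
    (P : (Σ m : ℕ, 𝓢((Fin m → E4), ℂ)) → (Σ m : ℕ, 𝓢((Fin m → E4), ℂ)))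
    (hP : P = fun Gσ => ⟨1 + (1 + Gσ.1), translateMulti ((2 * u + v) • EuclideanSpace.single 0 1)
      ((osAdjoint f₁).appendTensor
        (f₁.appendTensor (translateMulti ((2 * u + v) • EuclideanSpace.single 0 1) Gσ.2)))⟩) (N : ℕ) :
    (S (n + (P^[N] ⟨n, W⟩).1) ((osAdjoint W).appendTensor (P^[N] ⟨n, W⟩).2)).re ≤
      (A ^ (2 * n) * (∫ x, ‖W x‖) ^ 2) * (A * ∫ x, ‖f₁ x‖) ^ (2 * N) := by
  have hadm := adm_iterate' u v hu hv f₁ hf₁ P hP N ⟨n, W⟩ hW hFW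
  have hoff : IsOffDiagonal ((osAdjoint W).appendTensor (P^[N] ⟨n, W⟩).2) :=
    OSReconstructionNoE1.isOffDiagonal_appendTensor_osAdjoint hW hadm.1
  have hdeg : n + (P^[N] ⟨n, W⟩).1 = 2 * n + 2 * N := by
    rw [fst_iterate (2 * u + v) f₁ P hP N ⟨n, W⟩]
    simp only
    ring
  calc (S (n + (P^[N] ⟨n, W⟩).1) ((osAdjoint W).appendTensor (P^[N] ⟨n, W⟩).2)).re
      ≤ ‖S (n + (P^[N] ⟨n, W⟩).1) ((osAdjoint W).appendTensor (P^[N] ⟨n, W⟩).2)‖ := Complex.re_le_norm _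
    _ ≤ A ^ (n + (P^[N] ⟨n, W⟩).1) * ∫ x, ‖(osAdjoint W).appendTensor (P^[N] ⟨n, W⟩).2 x‖ := hA _ _ hoff
    _ = A ^ (2 * n + 2 * N) * ((∫ x, ‖W x‖) * ((∫ x, ‖f₁ x‖) ^ (2 * N) * ∫ x, ‖W x‖)) := by
        have hpow : A ^ (n + (P^[N] ⟨n, W⟩).1) = A ^ (2 * n + 2 * N) := by rw [hdeg]
        rw [hpow, integral_norm_appendTensor, integral_norm_osAdjoint, integral_norm_iterate (2 * u + v) f₁ P hP N]
    _ = (A ^ (2 * n) * (∫ x, ‖W x‖) ^ 2) * (A * ∫ x, ‖f₁ x‖) ^ (2 * N) := by ring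

/-- **THE SANDWICH ROW WITH EXPONENT `μ = 0` FOR ORDER-ZERO FAMILIES (model-blind).**  If `‖𝔖ₘ F‖ ≤ Aᵐ ∫ |F|` for
every degree `m` and every `F ∈ ⁰𝒮`, then for every `e₀`-reconstruction `h` of `S` the transversely filtered
heat-sandwich row of the crux holds with `μ = 0 (< 4)` and `C = A/2`: for all `0 < u, v ≤ 1`, every windowed
insertion `f₁ = g ⊗ hh` (`g` in the time window `[u, 2u]`, `∫|g| ≤ Mg`, `∫|hh| ≤ Mh`, `|hh| ≤ Mh'`) and every
admissible time-ordered `W`, `‖Ψ_{f₁ ⊗ T_{2u+v}W}‖ ≤ C · Mg · (Mh + Mh') · (u⁻⁰ + v⁻⁰) · ‖Ψ_W‖`.  Proof: the landed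
engine `sandwich_of_chainGrowth` with `Λ = A ∫|f₁| ≤ A · Mg · Mh` and the order-zero chain growth. -/
theorem sandwich_of_orderZero (S : SchwingerFamily E4) {A : ℝ} (hA0 : 0 ≤ A)
    (hA : ∀ (m : ℕ) (F : 𝓢((Fin m → E4), ℂ)), IsOffDiagonal F → ‖S m F‖ ≤ A ^ m * ∫ y, ‖F y‖)
    (h : OSReconstructionNoE1 S.toLabelled) :
    ∃ μ C : ℝ, μ < 4 ∧
      (∀ (u v : ℝ), 0 < u → 0 < v → u ≤ 1 → v ≤ 1 →
        ∀ (f₁ : SchwartzMap (Fin 1 → E4) ℂ) (g hh : ℝ × ℝ → ℂ) (Mg Mh Mh' : ℝ),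
          (∀ x : Fin 1 → E4, f₁ x = g (x 0 0, x 0 1) * hh (x 0 2, x 0 3)) →
          (∀ p : ℝ × ℝ, g p ≠ 0 → u ≤ p.1 ∧ p.1 ≤ 2 * u) →
          MeasureTheory.Integrable g → (∫ p, ‖g p‖) ≤ Mg →
          MeasureTheory.Integrable hh → (∫ p, ‖hh p‖) ≤ Mh → (∀ p, ‖hh p‖ ≤ Mh') →
        ∀ (n : ℕ) (W : SchwartzMap (Fin n → E4) ℂ) (hW : IsTimeOrdered W)
          (hFW : IsTimeOrdered
            (SchwartzMap.appendTensor f₁ (translateMulti ((2 * u + v) • EuclideanSpace.single 0 1) W))),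
          ‖h.fieldVec (1 + n) (fun _ => ())
              (SchwartzMap.appendTensor f₁ (translateMulti ((2 * u + v) • EuclideanSpace.single 0 1) W)) hFW‖
            ≤ C * Mg * (Mh + Mh') * (u ^ (-μ) + v ^ (-μ)) * ‖h.fieldVec n (fun _ => ()) W hW‖) := by
  refine ⟨0, A / 2, by norm_num, ?_⟩
  intro u v hu hv _ _ f₁ g hh Mg Mh Mh' hf₁ hg _ hgM _ hhM hhM' n W hW hFW
  have hMg : 0 ≤ Mg := (integral_nonneg fun _ => norm_nonneg _).trans hgM
  have hMh' : 0 ≤ Mh' := (norm_nonneg _).trans (hhM' 0)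
  have hsupp := tsupport_subset_window hf₁ hg
  -- the rate `Λ = A ∫|f₁|`
  set Λ : ℝ := A * ∫ x, ‖f₁ x‖ with hΛdef
  have hI0 : 0 ≤ ∫ x, ‖f₁ x‖ := integral_nonneg fun _ => norm_nonneg _
  have hΛ0 : 0 ≤ Λ := mul_nonneg hA0 hI0
  have key := sandwich_of_chainGrowth S h u v hu hv f₁ hsupp Λ hΛ0 W hW hFW
    (A ^ (2 * n) * (∫ x, ‖W x‖) ^ 2) (by positivity) _ rfl
    (fun N => chainGrowth_of_orderZero S hA u v hu hv f₁ hsupp W hW hFW _ rfl N)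
  -- `Λ ≤ A · Mg · Mh ≤ (A/2) · Mg · (Mh + Mh') · 2`
  have hΛle : Λ ≤ A / 2 * Mg * (Mh + Mh') * (u ^ (-(0 : ℝ)) + v ^ (-(0 : ℝ))) := by
    rw [neg_zero, Real.rpow_zero, Real.rpow_zero, hΛdef]
    have h1 : (∫ x, ‖f₁ x‖) ≤ Mg * Mh := integral_norm_window_le f₁ hf₁ hgM hhM
    have h2 : Mg * Mh ≤ Mg * (Mh + Mh') := mul_le_mul_of_nonneg_left (le_add_of_nonneg_right hMh') hMg
    nlinarith [mul_le_mul_of_nonneg_left (h1.trans h2) hA0]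
  exact key.trans (mul_le_mul_of_nonneg_right hΛle (norm_nonneg _))

/-- **Registered form (stub `stub_sandwichOfOrderZero` of crux stmt-QuantumFields-14999): the `e₀` sandwich row of
the crux, with SOME exponent `μ < 4`, for every order-zero one-species family and every `e₀`-reconstruction of it**
(model-blind; `μ = 0`, `C = A/2` by `sandwich_of_orderZero`). -/
theorem stub_sandwichOfOrderZero :
    open Literature.MathematicalPhysics.QuantumLattice Literature.MathematicalPhysics.AQFT
      Literature.MathematicalPhysics.QuantumFieldTheory
      Summit.QuantumFields.YangMills.Theorems.CurvatureBoostCovariance.Negative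
      Summit.QuantumFields.YangMills.Theorems.NPointIsotropy.Negative in
    ∀ (S : SchwingerFamily E4) (A : ℝ), 0 ≤ A →
      (∀ (m : ℕ) (F : SchwartzMap (Fin m → E4) ℂ), IsOffDiagonal F → ‖S m F‖ ≤ A ^ m * ∫ y : Fin m → E4, ‖F y‖) →
      ∀ (h : OSReconstructionNoE1 S.toLabelled), ∃ μ C : ℝ, μ < 4 ∧
        (∀ (u v : ℝ), 0 < u → 0 < v → u ≤ 1 → v ≤ 1 →
          ∀ (f₁ : SchwartzMap (Fin 1 → E4) ℂ) (g hh : ℝ × ℝ → ℂ) (Mg Mh Mh' : ℝ),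
            (∀ x : Fin 1 → E4, f₁ x = g (x 0 0, x 0 1) * hh (x 0 2, x 0 3)) →
            (∀ p : ℝ × ℝ, g p ≠ 0 → u ≤ p.1 ∧ p.1 ≤ 2 * u) →
            MeasureTheory.Integrable g → (∫ p, ‖g p‖) ≤ Mg →
            MeasureTheory.Integrable hh → (∫ p, ‖hh p‖) ≤ Mh → (∀ p, ‖hh p‖ ≤ Mh') →
          ∀ (n : ℕ) (W : SchwartzMap (Fin n → E4) ℂ) (hW : IsTimeOrdered W)
            (hFW : IsTimeOrdered
              (SchwartzMap.appendTensor f₁ (translateMulti ((2 * u + v) • EuclideanSpace.single 0 1) W))),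
            ‖h.fieldVec (1 + n) (fun _ => ())
                (SchwartzMap.appendTensor f₁ (translateMulti ((2 * u + v) • EuclideanSpace.single 0 1) W)) hFW‖
              ≤ C * Mg * (Mh + Mh') * (u ^ (-μ) + v ^ (-μ)) * ‖h.fieldVec n (fun _ => ()) W hW‖) :=
  fun S _A hA0 hA h => sandwich_of_orderZero S hA0 hA h

end Summit.QuantumFields.YangMills.Theorems.SoftKernelBoostCovariance.Sketch.TameSector

end
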